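import Literature.NumberTheory.GaloisRepresentations.DirichletCharacterOfGaloisCharacter
import Literature.NumberTheory.GaloisRepresentations.TeichmullerCharacter
import Literature.NumberTheory.GaloisRepresentations.CyclotomicCharacterFrobeniusProofs
import Literature.NumberTheory.GaloisRepresentations.OddAbsolutelyIrreducibleProofs
import Literature.NumberTheory.GaloisRepresentations.ArtinDirichletCoefficients
import Literature.NumberTheory.GaloisRepresentations.AbsGaloisGroup
import HarnessLib

/-!
# Billerey–Menares, Thm. 2: the dictionary `η ↦ (N, χ)` (proofs only)

Topic `Literature/NumberTheory/EllipticCurves`; namespace `Literature.NumberTheory.EllipticCurves`.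
THEOREMS ONLY (no definition, no named fact).  A proofs-only companion of the named fact
`Literature.NumberTheory.EllipticCurves.BillereyMenares2018_exists_newform`
(`EisensteinNewformLevelRaising.lean`), formalising Step 0 and the final bookkeeping of the proof
of Billerey–Menares, Thm. 2 (N. Billerey, R. Menares, *Strong modularity of reducible Galois
representations*, Trans. AMS 370 (2018), §2.1 and §3.2): from the `p`-adic character `η` of the
fact to the PRIMITIVE DIRICHLET CHARACTER `χ` (the Teichmüller lift of `ε₂ = \bar η · ω^{1-k}`,
"seen as a Dirichlet character") and its level `N` (the conductor, prime to `p`), with all the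
congruences the fact's conclusion is phrased in.

`exists_dirichletCharacter_of_padicCharacter`: let `p ≥ 3`, `ι : ℚ̄_p ≃ ℂ`,
`η : Γ_ℚ → ℚ̄_pˣ` continuous and unit-valued, `k ≥ 1`, `η(c) ≡ -1` at complex conjugations, and
`η ≡ χ_p^{k-1} (mod 𝔪)` on the inertia group of one prime above `p`.  Put
`θ = η · χ_p^{1-k} : Γ_ℚ → 𝒪ˣ` (unit-valued, continuous).  Then there are `N ≥ 1` with `p ∤ N`
and a primitive Dirichlet character `χ` modulo `N` such that

1. `χ(-1) = (-1)^k` (parity: `θ(c) ≡ (-1)(-1)^{1-k}`, `χ_N(c) = -1`, and `1 ≢ -1` as `p ≠ 2`);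
2. `χ^m = 1` for some `m ≥ 1` prime to `p` (the Teichmüller lift has order prime to `p`);
3. `ι⁻¹(χ(χ_N(τ))) · χ_p(τ)^{k-1} ≡ η(τ) (mod 𝔪)` for all `τ ∈ Γ_ℚ`;
4. `ι⁻¹(χ(ℓ) ℓ^{k-1}) ≡ η(Frob_𝔏)` for every prime `ℓ ∤ Np`, prime `𝔏 ∣ ℓ` of `ℤ̄` and arithmetic
   Frobenius (`χ_N(Frob) = ℓ`, `χ_p(Frob) = ℓ`) — the shape of the last clause of the fact;
5. for a prime `M ≠ p` at which `η` is unramified modulo `𝔪`: `M ∤ N` (ramification is read off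
   the conductor), and if moreover `η(Frob_M) M ≡ 1` then `χ(M) M^k ≡ 1 (mod 𝔪)` under `ι⁻¹` —
   Billerey–Menares' level-raising condition "`η(M) M^k = 1`" (their `η = ε₁⁻¹ε₂ = ε₂`), which
   makes the constant terms of `F₂ = E - E(M·)` vanish modulo `𝔪`
   (`EisensteinSeriesNebentypusCusps`).

Ingredients (all in the tree): the Teichmüller lift of `θ` as a complex character with open
kernel (`exists_complexCharacter_of_teichmuller`, `TeichmullerCharacter`); Kronecker–Weber and
conductors (`exists_isPrimitive_dirichletCharacter_of_isOpen_ker`,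
`not_dvd_level_of_isPrimitive_of_forall_mem_inertia`, `DirichletCharacterOfGaloisCharacter`);
`χ_p(Frob_v) = N v` (`GaloisRep.cyclotomicCharacter_apply_of_isArithFrobAt`), `χ_p(c) = -1`
(`GaloisRep.cyclotomicCharacter_of_isComplexConjugation`), `χ_p(I_𝔓) = 1` for `𝔓 ∤ p`
(`smul_eq_self_of_mem_inertia_of_pow_prime_pow_eq_one`), `χ_N(c) = -1`
(`modNCyclotomicCharacter_of_isComplexConjugation`).

## References

* N. Billerey, R. Menares, *Strong modularity of reducible Galois representations*, Trans. AMS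
  370 (2018), §2.1 (`N`, `k`, `ε₁`, `ε₂`), §3.2 (proof of Thm. 2). [BillereyMenares2018]
* L. C. Washington, *Introduction to Cyclotomic Fields*, GTM 83 (1997), Ch. 3 and §5.1.
  [Washington1997]
-/

noncomputable section

open Field IsDedekindDomain NumberField Rat.HeightOneSpectrum
open Literature.NumberTheory.GaloisRepresentations

namespace Literature.NumberTheory.EllipticCurves

/-! ### Places of `ℚ` -/

section Places

/-- The rational prime `q` lies in the place `primesEquiv⁻¹ q` of `ℚ`. [folklore] -/
theorem natCast_mem_asIdeal_primesEquiv_symm (q : ℕ) (hq : q.Prime) :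
    (q : 𝓞 ℚ) ∈ ((primesEquiv (R := 𝓞 ℚ)).symm ⟨q, hq⟩).asIdeal := by
  set v : HeightOneSpectrum (𝓞 ℚ) := (primesEquiv (R := 𝓞 ℚ)).symm ⟨q, hq⟩ with hv
  have hgen : natGenerator v = q := by
    have h := (primesEquiv (R := 𝓞 ℚ)).apply_symm_apply ⟨q, hq⟩
    exact congrArg Subtype.val h
  have h : natGenerator v ∣ q := hgen ▸ dvd_rfl
  rwa [natGenerator_dvd_iff, ← map_natCast (Rat.IsIntegralClosure.intEquiv (𝓞 ℚ)) q,
    Ideal.apply_mem_of_equiv_iff] at h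

/-- Two distinct rational primes do not lie in the same place. [folklore] -/
theorem not_natCast_mem_asIdeal_of_ne {v : HeightOneSpectrum (𝓞 ℚ)} {q p : ℕ} (hq : q.Prime)
    (hp : p.Prime) (hvq : (q : 𝓞 ℚ) ∈ v.asIdeal) (hne : q ≠ p) : (p : 𝓞 ℚ) ∉ v.asIdeal :=
  fun hvp ↦ hne ((natGenerator_eq_of_natCast_mem_asIdeal hq hvq).symm.trans
    (natGenerator_eq_of_natCast_mem_asIdeal hp hvp))

/-- `N v = q` for the place `v ∋ q`. [folklore] -/
theorem residueCard_eq_of_natCast_mem_asIdeal {v : HeightOneSpectrum (𝓞 ℚ)} {q : ℕ}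
    (hq : q.Prime) (hv : (q : 𝓞 ℚ) ∈ v.asIdeal) : v.residueCard = q := by
  rw [Rat.residueCard_eq_natGenerator' v, natGenerator_eq_of_natCast_mem_asIdeal hq hv]

/-- **`χ_p(I_𝔓) = 1` for `𝔓` above a place `v ∌ p`** (inertia fixes the `p`-power roots of
unity; cf. `cyclotomicCharacter_eq_one_of_mem_inertia` of the sibling `…InertiaProofs`, not
imported here; private copy of `Hida2000Thm326.cyclotomicCharacter_eq_one_of_mem_inertia`).
[cite: SerreAbelianLadic1968, Ch. I §1.2 (Example: the cyclotomic character)] -/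
private theorem cyclotomicCharacter_eq_one_of_mem_inertia' {p : ℕ} [Fact p.Prime]
    {v : HeightOneSpectrum (𝓞 ℚ)} (hv : (p : 𝓞 ℚ) ∉ v.asIdeal)
    {𝔓 : Ideal (absIntegers (𝓞 ℚ) ℚ)} (h𝔓 : 𝔓 ∈ v.primesAbove)
    {σ : absoluteGaloisGroup ℚ} (hσ : σ ∈ 𝔓.inertia (absoluteGaloisGroup ℚ)) :
    GaloisRep.cyclotomicCharacter ℚ p σ = 1 := by
  rw [GaloisRep.cyclotomicCharacter_apply]
  refine cyclotomicCharacter_eq_one_of_forall_pow_eq_one p _ fun n t ht ↦ ?_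
  exact smul_eq_self_of_mem_inertia_of_pow_prime_pow_eq_one hv h𝔓 hσ ht

end Places

/-! ### Norm bookkeeping -/

section Norm

variable {p : ℕ} [Fact p.Prime]

/-- `Valued.v x < 1 ↔ ‖x‖ < 1` in `ℚ̄_p`. [folklore] -/
private theorem v_lt_one_iff (x : PadicAlgCl p) : Valued.v x < 1 ↔ ‖x‖ < 1 := by
  rw [PadicAlgCl.valuation_def, ← NNReal.coe_lt_coe, coe_nnnorm, NNReal.coe_one]

/-- The image of a `p`-adic unit in `ℚ̄_p` has norm `1`. [folklore] -/
theorem norm_algebraMap_padicInt_units (u : ℤ_[p]ˣ) :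
    ‖algebraMap ℚ_[p] (PadicAlgCl p) ((u : ℤ_[p]) : ℚ_[p])‖ = 1 := by
  rw [← PadicAlgCl.coe_eq]
  change ‖(((u : ℤ_[p]) : ℚ_[p]) : PadicAlgCl p)‖ = 1
  rw [PadicAlgCl.norm_extends, PadicInt.padic_norm_e_of_padicInt]
  exact PadicInt.isUnit_iff.1 u.isUnit

/-- `‖ℓ‖ = 1` in `ℚ̄_p` for a prime `ℓ ≠ p`. [folklore] -/
theorem norm_natCast_eq_one_of_prime_ne {ℓ : ℕ} (hℓ : ℓ.Prime) (hℓp : ℓ ≠ p) :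
    ‖(ℓ : PadicAlgCl p)‖ = 1 :=
  PadicAlgCl.norm_natCast_of_not_dvd fun h ↦ hℓp ((Nat.prime_dvd_prime_iff_eq Fact.out hℓ).1 h).symm

/-- Ultrametric inequality for differences. [folklore] -/
private theorem norm_sub_le_max' (x y : PadicAlgCl p) : ‖x - y‖ ≤ max ‖x‖ ‖y‖ := by
  have h := PadicAlgCl.isNonarchimedean p x (-y)
  rwa [norm_neg, ← sub_eq_add_neg] at h

/-- Multiplying a congruence by an element of norm `1`. [folklore] -/
theorem norm_mul_sub_mul_lt_one {x y u : PadicAlgCl p} (hu : ‖u‖ = 1) (h : ‖x - y‖ < 1) :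
    ‖x * u - y * u‖ < 1 := by
  rw [← sub_mul, norm_mul, hu, mul_one]; exact h

/-- Chaining two congruences modulo `𝔪`. [folklore] -/
theorem norm_sub_lt_one_trans {x y z : PadicAlgCl p} (h₁ : ‖x - y‖ < 1) (h₂ : ‖y - z‖ < 1) :
    ‖x - z‖ < 1 := by
  have : x - z = (x - y) + (y - z) := by ring
  rw [this]
  exact (PadicAlgCl.isNonarchimedean p _ _).trans_lt (max_lt h₁ h₂)

/-- `±1` are incongruent modulo `𝔪` for `p ≠ 2`. [folklore] -/
theorem norm_neg_one_sub_one (hp : p ≠ 2) : ‖(-1 : PadicAlgCl p) - 1‖ = 1 := by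
  rw [show (-1 : PadicAlgCl p) - 1 = -(2 : ℕ) by norm_num, norm_neg]
  exact PadicAlgCl.norm_natCast_of_not_dvd fun h ↦ hp
    ((Nat.prime_dvd_prime_iff_eq Fact.out Nat.prime_two).1 h)

end Norm

/-! ### The dictionary -/

section Dictionary

variable {p : ℕ} [Fact p.Prime]

/-- **Billerey–Menares, proof of Thm. 2, Step 0 (the Dirichlet character of `η`) and the final
bookkeeping.**  See the module docstring for the statement; `χ_p` is the `p`-adic cyclotomic
character `GaloisRep.cyclotomicCharacter ℚ p`, read in `ℚ̄_p` through `ℤ_p ⊂ ℚ_p ⊂ ℚ̄_p`, and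
`χ_N = modNCyclotomicCharacter ℚ N`. [cite: BillereyMenares2018, §2.1 and §3.2 (proof of Thm. 2); Washington1997, Ch. 3 and §5.1] -/
theorem exists_dirichletCharacter_of_padicCharacter (hp3 : 3 ≤ p) (ι : PadicAlgCl p ≃+* ℂ)
    (η : absoluteGaloisGroup ℚ →ₜ* (PadicAlgCl p)ˣ) {k : ℕ} (hk : 1 ≤ k)
    (hunit : ∀ τ, Valued.v ((η τ : (PadicAlgCl p)ˣ) : PadicAlgCl p) = 1)
    (hodd : ∀ c : absoluteGaloisGroup ℚ, IsComplexConjugation (Rat.castHom ℝ) c →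
      Valued.v (((η c : (PadicAlgCl p)ˣ) : PadicAlgCl p) + 1) < 1)
    (hIp : ∃ w : HeightOneSpectrum (𝓞 ℚ), (p : 𝓞 ℚ) ∈ w.asIdeal ∧ ∃ 𝔓 ∈ w.primesAbove,
      ∀ σ ∈ 𝔓.inertia (absoluteGaloisGroup ℚ),
        Valued.v (((η σ : (PadicAlgCl p)ˣ) : PadicAlgCl p) -
          algebraMap (Padic p) (PadicAlgCl p)
            (((GaloisRep.cyclotomicCharacter ℚ p σ).val : PadicInt p) : Padic p) ^ (k - 1)) < 1) :
    ∃ (N : ℕ) (_ : NeZero N) (χ : DirichletCharacter ℂ N), χ.IsPrimitive ∧ ¬ p ∣ N ∧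
      χ (-1) = (-1) ^ k ∧
      (∃ m : ℕ, 0 < m ∧ ¬ p ∣ m ∧ χ ^ m = 1) ∧
      (∀ τ : absoluteGaloisGroup ℚ,
        Valued.v (ι.symm (χ (modNCyclotomicCharacter ℚ N τ : ZMod N)) *
          algebraMap (Padic p) (PadicAlgCl p)
            (((GaloisRep.cyclotomicCharacter ℚ p τ).val : PadicInt p) : Padic p) ^ (k - 1) -
          ((η τ : (PadicAlgCl p)ˣ) : PadicAlgCl p)) < 1) ∧
      (∀ ℓ : ℕ, ℓ.Prime → ¬ ℓ ∣ N → ℓ ≠ p →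
        ∀ w : HeightOneSpectrum (𝓞 ℚ), (ℓ : 𝓞 ℚ) ∈ w.asIdeal → ∀ 𝔏 ∈ w.primesAbove,
          ∀ σ : absoluteGaloisGroup ℚ, IsArithFrobAt (𝓞 ℚ) σ 𝔏 →
            Valued.v (ι.symm ((χ (ℓ : ZMod N) : ℂ) * (ℓ : ℂ) ^ ((k : ℤ) - 1)) -
              ((η σ : (PadicAlgCl p)ˣ) : PadicAlgCl p)) < 1) ∧
      (∀ M : ℕ, M.Prime → M ≠ p →
        (∀ w : HeightOneSpectrum (𝓞 ℚ), (M : 𝓞 ℚ) ∈ w.asIdeal → ∀ 𝔓 ∈ w.primesAbove,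
          ∀ σ ∈ 𝔓.inertia (absoluteGaloisGroup ℚ),
            Valued.v (((η σ : (PadicAlgCl p)ˣ) : PadicAlgCl p) - 1) < 1) →
        ¬ M ∣ N ∧
        ((∀ w : HeightOneSpectrum (𝓞 ℚ), (M : 𝓞 ℚ) ∈ w.asIdeal → ∀ 𝔓 ∈ w.primesAbove,
            ∀ σ : absoluteGaloisGroup ℚ, IsArithFrobAt (𝓞 ℚ) σ 𝔓 →
              Valued.v (((η σ : (PadicAlgCl p)ˣ) : PadicAlgCl p) * (M : PadicAlgCl p) - 1) < 1) →
          Valued.v (ι.symm ((χ (M : ZMod N) : ℂ) * (M : ℂ) ^ (k : ℤ)) - 1) < 1)) := by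
  have hp2 : p ≠ 2 := by omega
  haveI : CharZero ℚ := inferInstance
  -- the `p`-adic cyclotomic character read in `ℚ̄_p`
  set φ : ℤ_[p] →+* PadicAlgCl p := (algebraMap ℚ_[p] (PadicAlgCl p)).comp PadicInt.Coe.ringHom
    with hφ
  have hφapply : ∀ x : ℤ_[p], φ x = algebraMap ℚ_[p] (PadicAlgCl p) (x : ℚ_[p]) := fun x ↦ rfl
  have hφcont : Continuous φ :=
    (continuous_algebraMap ℚ_[p] (PadicAlgCl p)).comp continuous_subtype_val
  set cyc := GaloisRep.cyclotomicCharacter ℚ p with hcyc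
  -- `u τ = χ_p(τ)` as a unit of `ℚ̄_p`, `c τ` its value
  set u : absoluteGaloisGroup ℚ → (PadicAlgCl p)ˣ := fun τ ↦ Units.map (φ : ℤ_[p] →* PadicAlgCl p) (cyc τ)
    with hu
  have huval : ∀ τ, ((u τ : (PadicAlgCl p)ˣ) : PadicAlgCl p) =
      algebraMap ℚ_[p] (PadicAlgCl p) (((cyc τ).val : ℤ_[p]) : ℚ_[p]) := fun τ ↦ rfl
  have hunorm : ∀ τ, ‖((u τ : (PadicAlgCl p)ˣ) : PadicAlgCl p)‖ = 1 := fun τ ↦ by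
    rw [huval]; exact norm_algebraMap_padicInt_units _
  have humul : ∀ a b, u (a * b) = u a * u b := fun a b ↦ by
    simp only [hu, map_mul]
  have hucont : Continuous u := (Continuous.units_map _ hφcont).comp cyc.continuous_toFun
  -- `θ = η · χ_p^{1-k}`
  let θ : absoluteGaloisGroup ℚ →ₜ* (PadicAlgCl p)ˣ :=
    { toFun := fun τ ↦ η τ * (u τ ^ (k - 1))⁻¹
      map_one' := by simp [show u 1 = 1 by simp [hu]]
      map_mul' := fun a b ↦ by
        rw [map_mul, humul, mul_pow, mul_inv, mul_mul_mul_comm]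
      continuous_toFun := η.continuous_toFun.mul ((hucont.pow _).inv) }
  have hθval : ∀ τ, ((θ τ : (PadicAlgCl p)ˣ) : PadicAlgCl p) =
      ((η τ : (PadicAlgCl p)ˣ) : PadicAlgCl p) * ((((u τ : (PadicAlgCl p)ˣ) : PadicAlgCl p)) ^ (k - 1))⁻¹ :=
    fun τ ↦ by
      show (((η τ * (u τ ^ (k - 1))⁻¹ : (PadicAlgCl p)ˣ)) : PadicAlgCl p) = _
      rw [Units.val_mul, Units.val_inv_eq_inv_val, Units.val_pow_eq_pow_val]
  have hηnorm : ∀ τ, ‖((η τ : (PadicAlgCl p)ˣ) : PadicAlgCl p)‖ = 1 := fun τ ↦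
    (PadicAlgCl.valuation_eq_one_iff _).1 (hunit τ)
  have hcknorm : ∀ τ, ‖(((u τ : (PadicAlgCl p)ˣ) : PadicAlgCl p)) ^ (k - 1)‖ = 1 := fun τ ↦ by
    rw [norm_pow, hunorm, one_pow]
  have hθnorm : ∀ τ, ‖((θ τ : (PadicAlgCl p)ˣ) : PadicAlgCl p)‖ = 1 := fun τ ↦ by
    rw [hθval, norm_mul, norm_inv, hηnorm, hcknorm, inv_one, mul_one]
  -- `θ ≡ 1 ↔ η ≡ χ_p^{k-1}`
  have hθcong : ∀ τ (x : PadicAlgCl p),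
      ‖x - ((θ τ : (PadicAlgCl p)ˣ) : PadicAlgCl p)‖ < 1 ↔
        ‖x * (((u τ : (PadicAlgCl p)ˣ) : PadicAlgCl p)) ^ (k - 1) -
          ((η τ : (PadicAlgCl p)ˣ) : PadicAlgCl p)‖ < 1 := fun τ x ↦ by
    have hne : (((u τ : (PadicAlgCl p)ˣ) : PadicAlgCl p)) ^ (k - 1) ≠ 0 :=
      norm_ne_zero_iff.1 (by rw [hcknorm]; exact one_ne_zero)
    have heq : x * (((u τ : (PadicAlgCl p)ˣ) : PadicAlgCl p)) ^ (k - 1) -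
        ((η τ : (PadicAlgCl p)ˣ) : PadicAlgCl p) =
        (x - ((θ τ : (PadicAlgCl p)ˣ) : PadicAlgCl p)) *
          (((u τ : (PadicAlgCl p)ˣ) : PadicAlgCl p)) ^ (k - 1) := by
      rw [hθval]; field_simp
    rw [heq, norm_mul, hcknorm, mul_one]
  -- Teichmüller lift, read in `ℂ`
  obtain ⟨n, ψ, hn0, hpn, hψn, hψcong, hψker, hψopen⟩ :=
    exists_complexCharacter_of_teichmuller ι θ hθnorm
  -- `ψ` is unramified at `p`
  obtain ⟨w₀, hw₀, 𝔓₀, h𝔓₀, hI₀⟩ := hIp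
  have hψI : ∀ τ ∈ 𝔓₀.inertia (absoluteGaloisGroup ℚ), ψ τ = 1 := fun τ hτ ↦ by
    rw [hψker]
    have h := (v_lt_one_iff _).1 (hI₀ τ hτ)
    rw [← huval] at h
    have h1 := (hθcong τ 1).2 (by rw [one_mul, ← norm_neg, neg_sub]; exact h)
    rwa [← norm_neg, neg_sub] at h1
  -- Kronecker–Weber: `ψ = χ ∘ χ_N`, `χ` primitive of conductor `N` prime to `p`
  obtain ⟨N, hN, χ, hχ, hpN, hψχ, hFrob⟩ :=
    exists_isPrimitive_dirichletCharacter_of_isOpen_ker ψ hψopen Fact.out hw₀ h𝔓₀ hψI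
  -- (3) the general congruence
  have hgen : ∀ τ : absoluteGaloisGroup ℚ,
      ‖ι.symm (χ (modNCyclotomicCharacter ℚ N τ : ZMod N)) *
          (((u τ : (PadicAlgCl p)ˣ) : PadicAlgCl p)) ^ (k - 1) -
        ((η τ : (PadicAlgCl p)ˣ) : PadicAlgCl p)‖ < 1 := fun τ ↦ by
    rw [← hθcong, ← hψχ τ]
    exact hψcong τ
  refine ⟨N, hN, χ, hχ, hpN, ?_, ⟨n, hn0, hpn, ?_⟩, fun τ ↦ ?_, fun ℓ hℓ hℓN hℓp w hw 𝔏 h𝔏 σ hσ ↦ ?_,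
    fun M hM hMp hIM ↦ ?_⟩
  · -- (1) parity
    obtain ⟨c, hc⟩ := exists_isComplexConjugation (Rat.castHom ℝ)
    have hcN : (modNCyclotomicCharacter ℚ N c : ZMod N) = -1 :=
      modNCyclotomicCharacter_of_isComplexConjugation hc
    have hcp : ((u c : (PadicAlgCl p)ˣ) : PadicAlgCl p) = -1 := by
      rw [huval, show (cyc c).val = ((cyc c : ℤ_[p]ˣ) : ℤ_[p]) from rfl,
        GaloisRep.cyclotomicCharacter_of_isComplexConjugation p hc]
      simp
    have h1 := hgen c
    rw [hcN, hcp] at h1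
    -- `ι⁻¹(χ(-1)) (-1)^{k-1} ≡ η(c) ≡ -1`
    have h2 : ‖ι.symm (χ (-1)) * (-1 : PadicAlgCl p) ^ (k - 1) - (-1)‖ < 1 := by
      refine norm_sub_lt_one_trans h1 ?_
      rw [sub_neg_eq_add]
      exact (v_lt_one_iff _).1 (hodd c hc)
    -- `χ(-1) = ±1`
    have hsq : χ (-1) * χ (-1) = 1 := by rw [← map_mul, neg_one_mul, neg_neg, map_one]
    have hpm : χ (-1) = 1 ∨ χ (-1) = -1 := by
      have : (χ (-1) - 1) * (χ (-1) + 1) = 0 := by ring_nf; linear_combination hsq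
      rcases mul_eq_zero.1 this with h | h
      · exact Or.inl (sub_eq_zero.1 h)
      · exact Or.inr (eq_neg_of_add_eq_zero_left h)
    -- compare with `(-1)^k`
    by_contra hne
    have hval : χ (-1) = -(-1) ^ k := by
      rcases hpm with h | h <;> rcases neg_one_pow_eq_or ℂ k with h' | h'
      · exact absurd (h.trans h'.symm) hne
      · rw [h, h']; norm_num
      · rw [h, h']
      · exact absurd (h.trans h'.symm) hne
    rw [hval, map_neg, map_pow, map_neg, map_one] at h2
    have heq : -(-1 : PadicAlgCl p) ^ k * (-1) ^ (k - 1) - -1 = -((-1 : PadicAlgCl p) - 1) * 1 := by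
      obtain ⟨j, rfl⟩ : ∃ j, k = j + 1 := ⟨k - 1, by omega⟩
      simp only [Nat.add_sub_cancel]
      ring_nf
      rw [show j * 2 = 2 * j by ring, pow_mul]
      norm_num
    rw [heq, mul_one, norm_neg, norm_neg_one_sub_one hp2] at h2
    exact lt_irrefl _ h2
  · -- (2) order prime to `p`
    refine MulChar.ext fun a ↦ ?_
    obtain ⟨σ, hσ⟩ := modNCyclotomicCharacter_rat_surjective N a
    rw [MulChar.pow_apply_coe, MulChar.one_apply_coe, ← hσ, ← hψχ σ, ← Units.val_pow_eq_pow_val,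
      hψn σ, Units.val_one]
  · -- (3)
    rw [v_lt_one_iff, ← huval]
    exact hgen τ
  · -- (4) Frobenius form
    have hpw : (p : 𝓞 ℚ) ∉ w.asIdeal := not_natCast_mem_asIdeal_of_ne hℓ Fact.out hw hℓp
    have hcycσ : ((u σ : (PadicAlgCl p)ˣ) : PadicAlgCl p) = (ℓ : PadicAlgCl p) := by
      rw [huval, show (cyc σ).val = ((cyc σ : ℤ_[p]ˣ) : ℤ_[p]) from rfl,
        GaloisRep.cyclotomicCharacter_apply_of_isArithFrobAt hpw h𝔏 hσ,
        residueCard_eq_of_natCast_mem_asIdeal hℓ hw]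
      simp
    have hψσ : (ψ σ : ℂ) = χ (ℓ : ZMod N) := (hFrob ℓ hℓ hℓN w hw 𝔏 h𝔏).1 σ hσ
    have h := hgen σ
    rw [← hψχ σ, hψσ, hcycσ] at h
    have heq : ι.symm ((χ (ℓ : ZMod N) : ℂ) * (ℓ : ℂ) ^ ((k : ℤ) - 1)) =
        ι.symm (χ (ℓ : ZMod N)) * (ℓ : PadicAlgCl p) ^ (k - 1) := by
      rw [map_mul, map_zpow₀, map_natCast ι.symm, show ((k : ℤ) - 1) = ((k - 1 : ℕ) : ℤ) by omega,
        zpow_natCast]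
    rw [v_lt_one_iff, heq]
    exact h
  · -- (5) the level-raising prime `M`
    set wM : HeightOneSpectrum (𝓞 ℚ) := (primesEquiv (R := 𝓞 ℚ)).symm ⟨M, hM⟩ with hwM
    have hMw : (M : 𝓞 ℚ) ∈ wM.asIdeal := natCast_mem_asIdeal_primesEquiv_symm M hM
    have hpwM : (p : 𝓞 ℚ) ∉ wM.asIdeal := not_natCast_mem_asIdeal_of_ne hM Fact.out hMw hMp
    obtain ⟨𝔔, h𝔔⟩ := wM.primesAbove_nonempty
    -- `ψ` is unramified at `M`
    have hψIM : ∀ τ ∈ 𝔔.inertia (absoluteGaloisGroup ℚ),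
        ((dirichletGaloisCharacter ℚ χ τ : ℂˣ) : ℂ) = 1 := fun τ hτ ↦ by
      have h1 : ψ τ = 1 := by
        rw [hψker]
        have hu1 : u τ = 1 := by
          show Units.map (φ : ℤ_[p] →* PadicAlgCl p) (cyc τ) = 1
          rw [hcyc, cyclotomicCharacter_eq_one_of_mem_inertia' hpwM h𝔔 hτ, map_one]
        have h := (v_lt_one_iff _).1 (hIM wM hMw 𝔔 h𝔔 τ hτ)
        rw [hθval, hu1, Units.val_one, one_pow, inv_one, mul_one]
        exact h
      rw [coe_dirichletGaloisCharacter_apply, ← hψχ τ, h1, Units.val_one]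
    have hMN : ¬ M ∣ N := not_dvd_level_of_isPrimitive_of_forall_mem_inertia hχ hM hMw h𝔔 hψIM
    refine ⟨hMN, fun hFM ↦ ?_⟩
    obtain ⟨σ, hσ⟩ := HeightOneSpectrum.exists_isArithFrobAt_of_mem_primesAbove_holds h𝔔
    -- `ι⁻¹(χ(M)) M^{k-1} ≡ η(Frob_M)` and `η(Frob_M) M ≡ 1`
    have hcycσ : ((u σ : (PadicAlgCl p)ˣ) : PadicAlgCl p) = (M : PadicAlgCl p) := by
      rw [huval, show (cyc σ).val = ((cyc σ : ℤ_[p]ˣ) : ℤ_[p]) from rfl,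
        GaloisRep.cyclotomicCharacter_apply_of_isArithFrobAt hpwM h𝔔 hσ,
        residueCard_eq_of_natCast_mem_asIdeal hM hMw]
      simp
    have hψσ : (ψ σ : ℂ) = χ (M : ZMod N) := (hFrob M hM hMN wM hMw 𝔔 h𝔔).1 σ hσ
    have h1 := hgen σ
    rw [← hψχ σ, hψσ, hcycσ] at h1
    have hMnorm : ‖(M : PadicAlgCl p)‖ = 1 := norm_natCast_eq_one_of_prime_ne hM hMp
    have h2 := norm_mul_sub_mul_lt_one hMnorm h1
    have h3 := (v_lt_one_iff _).1 (hFM wM hMw 𝔔 h𝔔 σ hσ)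
    have h4 := norm_sub_lt_one_trans h2 h3
    have heq : ι.symm ((χ (M : ZMod N) : ℂ) * (M : ℂ) ^ (k : ℤ)) =
        ι.symm (χ (M : ZMod N)) * (M : PadicAlgCl p) ^ (k - 1) * (M : PadicAlgCl p) := by
      rw [map_mul, map_zpow₀, map_natCast ι.symm, zpow_natCast, mul_assoc, ← pow_succ,
        Nat.sub_add_cancel hk]
    rw [v_lt_one_iff, heq]
    exact h4

end Dictionary

end Literature.NumberTheory.EllipticCurves
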